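import Literature.AlgebraicGeometry.HodgeTheory.HypersurfaceResidueFormulaLocal
import Literature.Geometry.Kaehler.HolomorphicTopFormsLine
import Literature.Geometry.Kaehler.HolomorphicFormsInCharts
import Mathlib.Geometry.Manifold.Complex

/-!
# Holomorphic top forms on a smooth hypersurface of degree `d ≤ n + 1` vanish (`h^{n,0}(X_d) = 0`)

Prover seat `hodge-nonav-prover-Bx` (g11), cell `hodge-nonav`, programme PG-GENERAL, phase 2. `M` is a compact
connected complex manifold charted on `E` (`dim_ℂ E = m ≥ 1`), embedded by `ψ` into the projective zero locus of a
homogeneous `F` of degree `1 ≤ d ≤ m + 1` with non-vanishing gradient there (holomorphic affine coordinates). Then EVERY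
`m`-form on `M` holomorphic in charts VANISHES (`eq_zero_of_isHolomorphicInCharts`, `finrank_holFormsInCharts_eq_zero`):
with the tree's fixed-index residue frames `ω_k = det(N, Z̃_k, dZ̃_k ·)` on the charts `M_k = ψ⁻¹(U_k)`
(`HypersurfaceResidueFormulaLocal`: holomorphic, nowhere zero, transition `(x_{k'}/x_k)^{d-m-2}`), the ratios
`f_k = η/ω_k` are holomorphic (`mdifferentiableAt_ratio`, via the localised quotient lemma
`mdifferentiableAt_topFormRatio_local`) and satisfy `f_{k'} = (Z̃_k)_{k'}^{e} f_k`, `e = m + 2 - d ≥ 1`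
(`ratio_transition`); so `G_i = f_k · (Z̃_k)_i^{e}` is a global holomorphic function (`glue_eq`, `mdifferentiable_glue`),
constant on the compact connected `M`, and the constant is `0` — otherwise `ψ(M) ⊆ U_i` and the affine coordinates,
global holomorphic functions, would be constant, making the embedding `ψ` constant on the positive-dimensional `M`
(`false_of_forall_mem_liftDomain`, `glue_eq_zero`); hence `f_k = 0` and `η = f_k ω_k = 0`. In print:
`H⁰(X, K_X) = H⁰(X, 𝒪_X(d - m - 2)) = 0` for `d < m + 2` (adjunction). Sorry-free; no definition, no named fact;
`--supports stmt-HodgeConjecture-19716 --as helper` (the case `d = 4` of the registered stub `stub_genusBoundThreefold`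
needs `h^{3,0}(X_4) = 0`). Nothing here says HC ∕ HC_AV is proved.
-/

noncomputable section

set_option linter.dupNamespace false
open scoped Manifold ContDiff Topology LinearAlgebra.Projectivization
open Set Filter Function Projectivization

namespace Summit.HodgeConjecture.HodgeConjecture.Theorems.SmoothHypersurfaceTopFormsVanish

open Literature.AlgebraicGeometry.HodgeTheory Literature.NumberTheory.Transcendental Literature.Geometry.Kaehler

/-! ### The quotient of a holomorphic top form by a local holomorphic frame -/

section Ratio

variable {n : ℕ} {E : Type*} [NormedAddCommGroup E] [NormedSpace ℂ E] [FiniteDimensional ℂ E]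
  {M : Type*} [TopologicalSpace M] [ChartedSpace E M] [IsManifold 𝓘(ℝ, E) ∞ M]

/-- **The quotient `η(e)/ω₀(e)` is holomorphic at `x₀`** when `η` is a holomorphic top form (holomorphic in charts),
`ω₀` has `ℂ`-multilinear values everywhere, an analytic chart representative at `x₀`, and `ω₀(e) ≠ 0` near `x₀`
(`e` a complex frame): in the chart `η̂ = F · ω̂₀` with `F = α/γ` a quotient of analytic germs. The tree's
`mdifferentiableAt_topFormRatio_of_isHolomorphicInCharts` with the hypotheses on `ω₀` localised at `x₀`.
[cite: Huybrechts2005, Prop. 2.6.11] [cite: VoisinHodgeII2003, §6.1.3] -/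
theorem mdifferentiableAt_topFormRatio_local (hn : Module.finrank ℂ E = n) {η ω₀ : MForm 𝓘(ℝ, E) M ℂ n}
    (hη : IsHolomorphicInCharts η) {e : Fin n → E} (he : LinearIndependent ℂ e) {x₀ : M}
    (hωC : ∀ x, ∃ a : E [⋀^Fin n]→L[ℂ] ℂ, (ω₀ x : E [⋀^Fin n]→L[ℝ] ℂ) = a.restrictScalars ℝ)
    (hω : ∃ g : E → E [⋀^Fin n]→L[ℂ] ℂ, AnalyticAt ℂ g (extChartAt 𝓘(ℝ, E) x₀ x₀) ∧
      ω₀.inChart x₀ =ᶠ[𝓝 (extChartAt 𝓘(ℝ, E) x₀ x₀)] fun y ↦ (g y).restrictScalars ℝ)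
    (hne : ∀ᶠ x in 𝓝 x₀, (ω₀ x : E [⋀^Fin n]→L[ℝ] ℂ) e ≠ 0) :
    MDifferentiableAt 𝓘(ℂ, E) 𝓘(ℂ, ℂ)
      (fun x ↦ (η x : E [⋀^Fin n]→L[ℝ] ℂ) e / (ω₀ x : E [⋀^Fin n]→L[ℝ] ℂ) e) x₀ := by
  have hcard : Fintype.card (Fin n) = Module.finrank ℂ E := by simp [hn]
  set b : Module.Basis (Fin n) ℂ E := basisOfLinearIndependentOfCardEqFinrank' e he hcard with hbdef
  have hb : (b : Fin n → E) = e := coe_basisOfLinearIndependentOfCardEqFinrank' e he hcard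
  set f : M → ℂ := fun x ↦ (η x : E [⋀^Fin n]→L[ℝ] ℂ) e / (ω₀ x : E [⋀^Fin n]→L[ℝ] ℂ) e with hfdef
  set φ := extChartAt 𝓘(ℝ, E) x₀ with hφ
  set y₀ : E := φ x₀ with hy₀
  set F : E → ℂ := f ∘ φ.symm with hF
  have hsymm : φ.symm y₀ = x₀ := extChartAt_to_inv x₀
  have hsymmc : ContinuousAt φ.symm y₀ := continuousAt_extChartAt_symm x₀
  have hne' : ∀ᶠ y in 𝓝 y₀, (ω₀ (φ.symm y) : E [⋀^Fin n]→L[ℝ] ℂ) e ≠ 0 := by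
    have h : ∀ᶠ x in 𝓝 (φ.symm y₀), (ω₀ x : E [⋀^Fin n]→L[ℝ] ℂ) e ≠ 0 := by rw [hsymm]; exact hne
    exact hsymmc.tendsto.eventually h
  have hAFG : ∀ᶠ y in 𝓝 y₀, η.inChart x₀ y = F y • ω₀.inChart x₀ y := by
    filter_upwards [hne'] with y hy
    obtain ⟨a, ha⟩ := hωC (φ.symm y)
    have hyb : (ω₀ (φ.symm y) : E [⋀^Fin n]→L[ℝ] ℂ) b ≠ 0 := by rw [hb]; exact hy
    have key := topForm_eq_ratio_smul hη.isOfType b ha hyb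
    rw [hb] at key
    simp only [hF, MForm.inChart, Function.comp_apply]
    rw [key]
    ext v
    rfl
  obtain ⟨gη, hgη, hAg⟩ := hη x₀
  obtain ⟨gω, hgω, hGg⟩ := hω
  change AnalyticAt ℂ gη y₀ at hgη
  change AnalyticAt ℂ gω y₀ at hgω
  change η.inChart x₀ =ᶠ[𝓝 y₀] fun y ↦ (gη y).restrictScalars ℝ at hAg
  change ω₀.inChart x₀ =ᶠ[𝓝 y₀] fun y ↦ (gω y).restrictScalars ℝ at hGg
  set γ : E → ℂ := fun y ↦ gω y e with hγ
  set α : E → ℂ := fun y ↦ gη y e with hα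
  have hγan : AnalyticAt ℂ γ y₀ := ((ContinuousAlternatingMap.apply ℂ E ℂ e).analyticAt _).comp hgω
  have hαan : AnalyticAt ℂ α y₀ := ((ContinuousAlternatingMap.apply ℂ E ℂ e).analyticAt _).comp hgη
  have hγ0 : γ y₀ ≠ 0 := by
    have h1 : (ω₀.inChart x₀ y₀ : E [⋀^Fin n]→L[ℝ] ℂ) e = γ y₀ := by rw [hGg.self_of_nhds]; rfl
    have h2 : ω₀.inChart x₀ y₀ = ω₀ x₀ := MForm.inChart_apply_self ω₀ x₀
    intro h0
    apply hne.self_of_nhds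
    have h3 : (ω₀.inChart x₀ y₀ : E [⋀^Fin n]→L[ℝ] ℂ) e = 0 := h1.trans h0
    rw [h2] at h3
    exact h3
  have hγne : ∀ᶠ y in 𝓝 y₀, γ y ≠ 0 := hγan.continuousAt.eventually_ne hγ0
  have hFeq : F =ᶠ[𝓝 y₀] fun y ↦ α y / γ y := by
    filter_upwards [hAFG, hAg, hGg, hγne] with y hyA hyη hyω hyne
    have h1 : (η.inChart x₀ y : E [⋀^Fin n]→L[ℝ] ℂ) e = F y * (ω₀.inChart x₀ y : E [⋀^Fin n]→L[ℝ] ℂ) e := by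
      rw [hyA, ContinuousAlternatingMap.smul_apply, smul_eq_mul]
    rw [hyη, hyω] at h1
    change α y = F y * γ y at h1
    rw [h1, mul_div_cancel_right₀ _ hyne]
  have hFdC : DifferentiableAt ℂ F y₀ :=
    ((hαan.div hγan hγ0).differentiableAt).congr_of_eventuallyEq hFeq
  rw [mdifferentiableAt_iff]
  refine ⟨?_, ?_⟩
  · have hev : (F ∘ φ) =ᶠ[𝓝 x₀] f := by
      filter_upwards [extChartAt_source_mem_nhds (I := 𝓘(ℝ, E)) x₀] with x hx
      simp only [hF, Function.comp_apply, φ.left_inv hx]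
    exact (hFdC.continuousAt.comp (continuousAt_extChartAt (I := 𝓘(ℝ, E)) x₀)).congr hev
  · simp only [writtenInExtChartAt, extChartAt_model_space_eq_id, PartialEquiv.refl_coe,
      CompTriple.comp_eq]
    exact hFdC.differentiableWithinAt

end Ratio

/-! ### The ratio functions of a holomorphic top form on the charts `M_k` -/

section Main

variable {m : ℕ} {E : Type*} [NormedAddCommGroup E] [NormedSpace ℂ E] [FiniteDimensional ℂ E]
  {M : Type*} [TopologicalSpace M] [ChartedSpace E M] [IsManifold 𝓘(ℂ, E) ω M]
  (ψ : M → ℙ ℂ (Fin (m + 2) → ℂ)) {F : MvPolynomial (Fin (m + 2)) ℂ} {d : ℕ}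

omit [FiniteDimensional ℂ E] [TopologicalSpace M] [ChartedSpace E M] [IsManifold 𝓘(ℂ, E) ω M] in
/-- `x ∈ M_k` and `(Z̃_k x)_i ≠ 0` give `x ∈ M_i` (the `i`-th homogeneous coordinate of `ψ x` is non-zero). [folklore] -/
theorem mem_liftDomain_of_apply_ne_zero {k i : Fin (m + 2)} {x : M} (hk : x ∈ liftDomain ψ k)
    (hi : projLift ψ k x i ≠ 0) : x ∈ liftDomain ψ i := by
  rw [mem_liftDomain_iff, stdChart_source, ← mk_projLift ψ hk, mk_mem_stdChartSource_iff]
  exact hi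

omit [FiniteDimensional ℂ E] [TopologicalSpace M] [ChartedSpace E M] [IsManifold 𝓘(ℂ, E) ω M] in
/-- On `M_k ∩ M_{k'}` the coordinate `(Z̃_k x)_{k'}` is non-zero. [folklore] -/
theorem projLift_apply_ne_zero_of_mem {k k' : Fin (m + 2)} {x : M} (hk : x ∈ liftDomain ψ k)
    (hk' : x ∈ liftDomain ψ k') : projLift ψ k x k' ≠ 0 := by
  intro h0
  have := projLift_eq_smul_of_mem ψ hk hk'
  rw [h0, inv_zero, zero_smul] at this
  exact projLift_ne_zero ψ k' x this

omit [FiniteDimensional ℂ E] [TopologicalSpace M] [ChartedSpace E M] [IsManifold 𝓘(ℂ, E) ω M] in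
/-- Admissibility of a normal index is invariant under rescaling the lift: `∂_jF(c z) ≠ 0 → ∂_jF(z) ≠ 0`
(`∂_jF` is homogeneous). [folklore] -/
theorem eval_pderiv_ne_zero_of_smul (hF : F.IsHomogeneous d) {c : ℂ} {z : Fin (m + 2) → ℂ} {j : Fin (m + 2)}
    (h : MvPolynomial.eval (c • z) (MvPolynomial.pderiv j F) ≠ 0) :
    MvPolynomial.eval z (MvPolynomial.pderiv j F) ≠ 0 := by
  rw [eval_smul_of_isHomogeneous hF.pderiv] at h
  exact right_ne_zero_of_mul h

omit [FiniteDimensional ℂ E] [TopologicalSpace M] [ChartedSpace E M] [IsManifold 𝓘(ℂ, E) ω M] in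
/-- The chosen normal index `j(Z̃_k x)` is admissible at `Z̃_k x` for `x ∈ M_k`. [folklore] -/
theorem residueJdx_admissible (hF : F.IsHomogeneous d) (hrange : Set.range ψ ⊆ projZeroLocus {F})
    (hjac : ∀ z : Fin (m + 2) → ℂ, z ≠ 0 → MvPolynomial.eval z F = 0 →
      ∃ j, MvPolynomial.eval z (MvPolynomial.pderiv j F) ≠ 0)
    {k : Fin (m + 2)} {x : M} (hk : x ∈ liftDomain ψ k) :
    MvPolynomial.eval (projLift ψ k x) (MvPolynomial.pderiv (residueJdx F (projLift ψ k x)) F) ≠ 0 :=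
  residueJdx_spec (hjac _ (projLift_ne_zero ψ k x) (eval_projLift_eq_zero ψ hF hrange hk))

/-- **The ratio `f_k = η(b)/det(N, Z̃_k x, dZ̃_k(x) ·)(b)` is holomorphic on `M_k`** (normal index chosen pointwise;
near `x₀` it may be frozen, `residueFormula_eq_of_jdx`, and then `mdifferentiableAt_topFormRatio_local` with the
analytic germ `exists_analyticGerm_residueFormula` and the non-vanishing `residueFormula_one_ne_zero`).
[cite: VoisinHodgeII2003, §6.1.3] -/
theorem mdifferentiableAt_ratio [IsManifold 𝓘(ℝ, E) ∞ M] (hF : F.IsHomogeneous d) (hψ : Topology.IsEmbedding ψ)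
    (hrange : Set.range ψ ⊆ projZeroLocus {F})
    (hjac : ∀ z : Fin (m + 2) → ℂ, z ≠ 0 → MvPolynomial.eval z F = 0 →
      ∃ j, MvPolynomial.eval z (MvPolynomial.pderiv j F) ≠ 0)
    (hhol : HasHolomorphicCoords E ψ) (hdim : Module.finrank ℂ E = m) (b : Module.Basis (Fin m) ℂ E)
    {η : MForm 𝓘(ℝ, E) M ℂ m} (hη : IsHolomorphicInCharts η) {k : Fin (m + 2)} {x₀ : M}
    (hx₀ : x₀ ∈ liftDomain ψ k) :
    MDifferentiableAt 𝓘(ℂ, E) 𝓘(ℂ, ℂ) (fun x ↦ (η x : E [⋀^Fin m]→L[ℝ] ℂ) b /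
      residueFormula ψ F 1 k (residueJdx F (projLift ψ k x)) x b) x₀ := by
  have hψc : Continuous ψ := hψ.continuous
  set j₀ := residueJdx F (projLift ψ k x₀) with hj₀def
  have hj₀ : MvPolynomial.eval (projLift ψ k x₀) (MvPolynomial.pderiv j₀ F) ≠ 0 :=
    residueJdx_admissible ψ hF hrange hjac hx₀
  have hcont : ContinuousAt (projLift ψ k) x₀ :=
    ((mdifferentiableOn_projLift ψ hhol k).continuousOn.continuousWithinAt hx₀).continuousAt
      ((isOpen_liftDomain ψ hψc k).mem_nhds hx₀)
  have hev : ContinuousAt (fun x ↦ MvPolynomial.eval (projLift ψ k x) (MvPolynomial.pderiv j₀ F)) x₀ :=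
    (MvPolynomial.continuous_eval _).continuousAt.comp hcont
  have hadm : ∀ᶠ x in 𝓝 x₀, x ∈ liftDomain ψ k ∧
      MvPolynomial.eval (projLift ψ k x) (MvPolynomial.pderiv j₀ F) ≠ 0 :=
    ((isOpen_liftDomain ψ hψc k).eventually_mem hx₀).and (hev.eventually_ne hj₀)
  set ω₀ : MForm 𝓘(ℝ, E) M ℂ m := fun x ↦
    show E [⋀^Fin m]→L[ℝ] ℂ from (residueFormula ψ F 1 k j₀ x).restrictScalars ℝ with hω₀
  have hω₀x : ∀ x, ω₀ x = (show E [⋀^Fin m]→L[ℝ] ℂ from (residueFormula ψ F 1 k j₀ x).restrictScalars ℝ) :=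
    fun x ↦ rfl
  have hne : ∀ᶠ x in 𝓝 x₀, (ω₀ x : E [⋀^Fin m]→L[ℝ] ℂ) b ≠ 0 := by
    filter_upwards [hadm] with x hx
    exact apply_ne_zero_of_ne_zero _ b (residueFormula_one_ne_zero ψ hF hψ hrange hjac hhol hdim hx.1 hx.2)
  have hmd := mdifferentiableAt_topFormRatio_local hdim hη b.linearIndependent (fun x ↦ ⟨_, hω₀x x⟩)
    (exists_analyticGerm_residueFormula ψ hψc hhol 1 hx₀ hj₀ hω₀x) hne
  refine hmd.congr_of_eventuallyEq ?_
  filter_upwards [hadm] with x hx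
  change (η x : E [⋀^Fin m]→L[ℝ] ℂ) b / residueFormula ψ F 1 k (residueJdx F (projLift ψ k x)) x b =
    (η x : E [⋀^Fin m]→L[ℝ] ℂ) b / residueFormula ψ F 1 k j₀ x b
  rw [residueFormula_eq_of_jdx ψ hF hψc hrange hhol 1 hx.1 (residueJdx_admissible ψ hF hrange hjac hx.1) hx.2]

omit [FiniteDimensional ℂ E] [IsManifold 𝓘(ℂ, E) ω M] in
/-- **Transition of the ratio functions**: on `M_k ∩ M_{k'}`, `f_{k'}(x) = (Z̃_k x)_{k'}^{e} f_k(x)` with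
`e = m + 2 - d` (the transition `(Z̃_k x)_{k'}^{d-m-2}` of the frames, `residueFormula_one_eq_zpow_smul`, and the
independence of the normal index, `residueFormula_eq_of_jdx`). In print: `η/ω_k` is a section of `𝒪_X(-e)`.
[cite: VoisinHodgeII2003, §6.1.3] [cite: Hartshorne1977, II Example 8.20.3] -/
theorem ratio_transition (hF : F.IsHomogeneous d) (hd : 1 ≤ d) (hψc : Continuous ψ)
    (hrange : Set.range ψ ⊆ projZeroLocus {F})
    (hjac : ∀ z : Fin (m + 2) → ℂ, z ≠ 0 → MvPolynomial.eval z F = 0 →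
      ∃ j, MvPolynomial.eval z (MvPolynomial.pderiv j F) ≠ 0)
    (hhol : HasHolomorphicCoords E ψ) {e : ℕ} (he : e + d = m + 2) (v : Fin m → E)
    (η : MForm 𝓘(ℝ, E) M ℂ m) {k k' : Fin (m + 2)} {x : M} (hk : x ∈ liftDomain ψ k) (hk' : x ∈ liftDomain ψ k') :
    (η x : E [⋀^Fin m]→L[ℝ] ℂ) v / residueFormula ψ F 1 k' (residueJdx F (projLift ψ k' x)) x v =
      projLift ψ k x k' ^ e *
        ((η x : E [⋀^Fin m]→L[ℝ] ℂ) v / residueFormula ψ F 1 k (residueJdx F (projLift ψ k x)) x v) := by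
  set t := projLift ψ k x k' with htdef
  have ht : t ≠ 0 := projLift_apply_ne_zero_of_mem ψ hk hk'
  set j' := residueJdx F (projLift ψ k' x) with hj'def
  have hj'k' : MvPolynomial.eval (projLift ψ k' x) (MvPolynomial.pderiv j' F) ≠ 0 :=
    residueJdx_admissible ψ hF hrange hjac hk'
  have hj'k : MvPolynomial.eval (projLift ψ k x) (MvPolynomial.pderiv j' F) ≠ 0 := by
    rw [projLift_eq_smul_of_mem ψ hk hk'] at hj'k'
    exact eval_pderiv_ne_zero_of_smul hF hj'k'
  have h1 := residueFormula_one_eq_zpow_smul ψ hF hd hψc hhol (j := j') hk hk'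
  have h2 : residueFormula (E := E) ψ F 1 k j' x = residueFormula ψ F 1 k (residueJdx F (projLift ψ k x)) x :=
    residueFormula_eq_of_jdx ψ hF hψc hrange hhol 1 hk hj'k (residueJdx_admissible ψ hF hrange hjac hk)
  have hexp : ((d : ℤ) - (m + 2 : ℕ)) = -(e : ℤ) := by push_cast; omega
  rw [h1, h2, hexp, zpow_neg, zpow_natCast, ContinuousAlternatingMap.smul_apply, smul_eq_mul]
  rw [← htdef]
  by_cases hr : residueFormula ψ F 1 k (residueJdx F (projLift ψ k x)) x v = 0
  · rw [hr]; simp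
  rw [div_mul_eq_div_div, div_inv_eq_mul, mul_comm, mul_div_assoc]

omit [FiniteDimensional ℂ E] [IsManifold 𝓘(ℂ, E) ω M] in
/-- **The glued function `G_i = f_k · (Z̃_k)_i^{e}` does not depend on the chart `k ∋ x`** (from `ratio_transition` and
`Z̃_{k'} = (Z̃_k)_{k'}⁻¹ Z̃_k`): its value computed with the pointwise chosen chart `residueIdx ψ x` equals its value
in any chart `M_k ∋ x`. [cite: Hartshorne1977, II Example 8.20.3] -/
theorem glue_eq (hF : F.IsHomogeneous d) (hd : 1 ≤ d) (hψc : Continuous ψ)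
    (hrange : Set.range ψ ⊆ projZeroLocus {F})
    (hjac : ∀ z : Fin (m + 2) → ℂ, z ≠ 0 → MvPolynomial.eval z F = 0 →
      ∃ j, MvPolynomial.eval z (MvPolynomial.pderiv j F) ≠ 0)
    (hhol : HasHolomorphicCoords E ψ) {e : ℕ} (he : e + d = m + 2) (v : Fin m → E)
    (η : MForm 𝓘(ℝ, E) M ℂ m) (i : Fin (m + 2)) {k : Fin (m + 2)} {x : M} (hk : x ∈ liftDomain ψ k) :
    (η x : E [⋀^Fin m]→L[ℝ] ℂ) v /
        residueFormula ψ F 1 (residueIdx ψ x) (residueJdx F (projLift ψ (residueIdx ψ x) x)) x v *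
      projLift ψ (residueIdx ψ x) x i ^ e =
    (η x : E [⋀^Fin m]→L[ℝ] ℂ) v / residueFormula ψ F 1 k (residueJdx F (projLift ψ k x)) x v *
      projLift ψ k x i ^ e := by
  set k' := residueIdx ψ x with hk'def
  have hk' : x ∈ liftDomain ψ k' := residueIdx_spec ψ x
  have ht : projLift ψ k x k' ≠ 0 := projLift_apply_ne_zero_of_mem ψ hk hk'
  rw [ratio_transition ψ hF hd hψc hrange hjac hhol he v η hk hk']
  have hcoord : projLift ψ k' x i = (projLift ψ k x k')⁻¹ * projLift ψ k x i := by
    rw [projLift_eq_smul_of_mem ψ hk hk']; rfl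
  rw [hcoord, mul_pow]
  set t := projLift ψ k x k'
  calc t ^ e * ((η x : E [⋀^Fin m]→L[ℝ] ℂ) v / residueFormula ψ F 1 k (residueJdx F (projLift ψ k x)) x v) *
        (t⁻¹ ^ e * projLift ψ k x i ^ e)
      = (η x : E [⋀^Fin m]→L[ℝ] ℂ) v / residueFormula ψ F 1 k (residueJdx F (projLift ψ k x)) x v *
          projLift ψ k x i ^ e * (t * t⁻¹) ^ e := by ring
    _ = _ := by rw [mul_inv_cancel₀ ht, one_pow, mul_one]

/-- **`G_i` is a global holomorphic function on `M`**: near `x₀` compute it in the chart `M_{k}`, `k = residueIdx ψ x₀`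
(`glue_eq`), where it is the product of the holomorphic `f_k` (`mdifferentiableAt_ratio`) and a power of the
holomorphic coordinate `(Z̃_k)_i`. [cite: VoisinHodgeII2003, §6.1.3] -/
theorem mdifferentiable_glue [IsManifold 𝓘(ℝ, E) ∞ M] (hF : F.IsHomogeneous d) (hd : 1 ≤ d)
    (hψ : Topology.IsEmbedding ψ) (hrange : Set.range ψ ⊆ projZeroLocus {F})
    (hjac : ∀ z : Fin (m + 2) → ℂ, z ≠ 0 → MvPolynomial.eval z F = 0 →
      ∃ j, MvPolynomial.eval z (MvPolynomial.pderiv j F) ≠ 0)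
    (hhol : HasHolomorphicCoords E ψ) (hdim : Module.finrank ℂ E = m) {e : ℕ} (he : e + d = m + 2)
    (b : Module.Basis (Fin m) ℂ E) {η : MForm 𝓘(ℝ, E) M ℂ m} (hη : IsHolomorphicInCharts η) (i : Fin (m + 2)) :
    MDifferentiable 𝓘(ℂ, E) 𝓘(ℂ, ℂ) (fun x ↦ (η x : E [⋀^Fin m]→L[ℝ] ℂ) b /
        residueFormula ψ F 1 (residueIdx ψ x) (residueJdx F (projLift ψ (residueIdx ψ x) x)) x b *
      projLift ψ (residueIdx ψ x) x i ^ e) := by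
  have hψc : Continuous ψ := hψ.continuous
  intro x₀
  set k := residueIdx ψ x₀ with hkdef
  have hk : x₀ ∈ liftDomain ψ k := residueIdx_spec ψ x₀
  have hgi : MDifferentiableAt 𝓘(ℂ, E) 𝓘(ℂ, Fin (m + 2) → ℂ) (projLift ψ k) x₀ :=
    (mdifferentiableOn_projLift ψ hhol k x₀ hk).mdifferentiableAt ((isOpen_liftDomain ψ hψc k).mem_nhds hk)
  have hcoord : MDifferentiableAt 𝓘(ℂ, E) 𝓘(ℂ, ℂ) (fun y ↦ projLift ψ k y i) x₀ :=
    mdifferentiableWithinAt_univ.mp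
      ((Literature.Geometry.Kaehler.mdifferentiableWithinAt_pi_space (s := univ)).mp
        hgi.mdifferentiableWithinAt i)
  have hprod := (mdifferentiableAt_ratio ψ hF hψ hrange hjac hhol hdim b hη hk).mul (hcoord.pow e)
  refine hprod.congr_of_eventuallyEq ?_
  filter_upwards [(isOpen_liftDomain ψ hψc k).mem_nhds hk] with x hx
  exact glue_eq ψ hF hd hψc hrange hjac hhol he b η i hx

omit [FiniteDimensional ℂ E] in
/-- **A compact connected complex manifold of positive dimension does not embed into one affine chart**: if
`ψ : M → ℙ^{m+1}` is an embedding with holomorphic affine coordinates and `ψ(M) ⊆ U_i`, the affine coordinates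
are global holomorphic functions on the compact connected `M`, hence constant (`MDifferentiable.apply_eq_of_compactSpace`),
so `ψ` is constant and `M` is a point — impossible for a manifold charted on `E ≠ 0`. [cite: Huybrechts2005, Prop. 2.6.11] -/
theorem false_of_forall_mem_liftDomain [CompactSpace M] [ConnectedSpace M] (hψ : Topology.IsEmbedding ψ)
    (hhol : HasHolomorphicCoords E ψ) (hdim : Module.finrank ℂ E = m) (hm : 0 < m) {i : Fin (m + 2)}
    (h : ∀ x, x ∈ liftDomain ψ i) : False := by
  haveI : Nontrivial E := Module.nontrivial_of_finrank_pos (R := ℂ) (by rw [hdim]; exact hm)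
  obtain ⟨x₀⟩ := (inferInstance : Nonempty M)
  have huniv : liftDomain ψ i = univ := eq_univ_of_forall h
  have hgi : MDifferentiable 𝓘(ℂ, E) 𝓘(ℂ, Fin (m + 2) → ℂ) (projLift ψ i) := by
    rw [← mdifferentiableOn_univ, ← huniv]; exact mdifferentiableOn_projLift ψ hhol i
  have hcoord : ∀ l, MDifferentiable 𝓘(ℂ, E) 𝓘(ℂ, ℂ) (fun y ↦ projLift ψ i y l) := fun l x ↦
    mdifferentiableWithinAt_univ.mp
      ((Literature.Geometry.Kaehler.mdifferentiableWithinAt_pi_space (s := univ)).mp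
        (hgi x).mdifferentiableWithinAt l)
  have hconst : ∀ x, projLift ψ i x = projLift ψ i x₀ := fun x ↦
    funext fun l ↦ (hcoord l).apply_eq_of_compactSpace (I := 𝓘(ℂ, E)) x x₀
  have hψconst : ∀ x, ψ x = ψ x₀ := by
    intro x
    have hx := mk_projLift ψ (h x)
    have hx₀ := mk_projLift ψ (h x₀)
    rw [← hx, ← hx₀]
    simp only [hconst x]
  have hsub : ∀ x, x = x₀ := fun x ↦ hψ.injective (hψconst x)
  -- `{x₀}` is open in `M`, hence its chart image `{chart x₀}` is open in `E`: impossible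
  have hopen : IsOpen ({x₀} : Set M) := by
    rw [show ({x₀} : Set M) = univ from eq_univ_of_forall fun x ↦ hsub x]; exact isOpen_univ
  have himg : IsOpen ((chartAt E x₀) '' {x₀}) :=
    (chartAt E x₀).isOpen_image_of_subset_source hopen (by simp)
  rw [image_singleton, isOpen_singleton_iff_punctured_nhds] at himg
  exact (Module.punctured_nhds_neBot ℂ E (chartAt E x₀ x₀)).ne himg

/-- **`G_i = 0`**: the global holomorphic function `G_i` is constant on the compact connected `M`; were the constant
non-zero, every `(Z̃ x)_i` would be non-zero (`e ≥ 1`), i.e. `ψ(M) ⊆ U_i`, contradicting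
`false_of_forall_mem_liftDomain`. [cite: Hartshorne1977, II Example 8.20.3] -/
theorem glue_eq_zero [CompactSpace M] [ConnectedSpace M] [IsManifold 𝓘(ℝ, E) ∞ M] (hF : F.IsHomogeneous d)
    (hd : 1 ≤ d) (hψ : Topology.IsEmbedding ψ) (hrange : Set.range ψ ⊆ projZeroLocus {F})
    (hjac : ∀ z : Fin (m + 2) → ℂ, z ≠ 0 → MvPolynomial.eval z F = 0 →
      ∃ j, MvPolynomial.eval z (MvPolynomial.pderiv j F) ≠ 0)
    (hhol : HasHolomorphicCoords E ψ) (hdim : Module.finrank ℂ E = m) (hm : 0 < m) {e : ℕ} (he : e + d = m + 2)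
    (he0 : 0 < e) (b : Module.Basis (Fin m) ℂ E) {η : MForm 𝓘(ℝ, E) M ℂ m} (hη : IsHolomorphicInCharts η)
    (i : Fin (m + 2)) (x : M) :
    (η x : E [⋀^Fin m]→L[ℝ] ℂ) b /
        residueFormula ψ F 1 (residueIdx ψ x) (residueJdx F (projLift ψ (residueIdx ψ x) x)) x b *
      projLift ψ (residueIdx ψ x) x i ^ e = 0 := by
  have hG := mdifferentiable_glue ψ hF hd hψ hrange hjac hhol hdim he b hη i
  obtain ⟨κ, hκ⟩ := hG.exists_eq_const_of_compactSpace (I := 𝓘(ℂ, E))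
  have hGx := congrFun hκ x
  simp only [Function.const_apply] at hGx
  rw [hGx]
  by_contra hκ0
  refine false_of_forall_mem_liftDomain ψ hψ hhol hdim hm (i := i) fun y ↦ ?_
  have hGy := congrFun hκ y
  simp only [Function.const_apply] at hGy
  have hne : projLift ψ (residueIdx ψ y) y i ^ e ≠ 0 := by
    intro h0
    rw [h0, mul_zero] at hGy
    exact hκ0 hGy.symm
  exact mem_liftDomain_of_apply_ne_zero ψ (residueIdx_spec ψ y) (ne_zero_pow he0.ne' hne)

/-- **Holomorphic top forms vanish in degree `d ≤ m + 1`**: `M` compact connected, charted on `E` with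
`dim_ℂ E = m ≥ 1`, `ψ : M → ℙ^{m+1}` an embedding with holomorphic affine coordinates into `{F = 0}`, `F` homogeneous
of degree `1 ≤ d ≤ m + 1` with non-vanishing gradient there; then every `m`-form holomorphic in charts is `0` (on each
chart `η = f_k ω_k`, `topForm_eq_ratio_smul`, with `f_k = G_k|_{M_k} = 0`). In print: `H⁰(X, 𝒪_X(d - m - 2)) = 0`.
[cite: Hartshorne1977, II Example 8.20.3] [cite: Arapura2012, §17.3 (17.3.1)] -/
theorem eq_zero_of_isHolomorphicInCharts [CompactSpace M] [ConnectedSpace M] [IsManifold 𝓘(ℝ, E) ∞ M]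
    (hF : F.IsHomogeneous d) (hd : 1 ≤ d) (hdm : d ≤ m + 1) (hψ : Topology.IsEmbedding ψ)
    (hrange : Set.range ψ ⊆ projZeroLocus {F})
    (hjac : ∀ z : Fin (m + 2) → ℂ, z ≠ 0 → MvPolynomial.eval z F = 0 →
      ∃ j, MvPolynomial.eval z (MvPolynomial.pderiv j F) ≠ 0)
    (hhol : HasHolomorphicCoords E ψ) (hdim : Module.finrank ℂ E = m) (hm : 0 < m)
    {η : MForm 𝓘(ℝ, E) M ℂ m} (hη : IsHolomorphicInCharts η) : η = 0 := by
  set b : Module.Basis (Fin m) ℂ E := Module.finBasisOfFinrankEq ℂ E hdim with hbdef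
  have he : (m + 2 - d) + d = m + 2 := by omega
  have he0 : 0 < m + 2 - d := by omega
  funext x
  set k := residueIdx ψ x with hkdef
  have hk : x ∈ liftDomain ψ k := residueIdx_spec ψ x
  have hG := glue_eq_zero ψ hF hd hψ hrange hjac hhol hdim hm he he0 b hη k x
  rw [glue_eq ψ hF hd hψ.continuous hrange hjac hhol he b η k hk, projLift_apply_self, one_pow, mul_one] at hG
  have hden : residueFormula ψ F 1 k (residueJdx F (projLift ψ k x)) x b ≠ 0 :=
    apply_ne_zero_of_ne_zero _ b
      (residueFormula_one_ne_zero ψ hF hψ hrange hjac hhol hdim hk (residueJdx_admissible ψ hF hrange hjac hk))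
  have hnum : (η x : E [⋀^Fin m]→L[ℝ] ℂ) b = 0 := (div_eq_zero_iff.mp hG).resolve_right hden
  have key := topForm_eq_ratio_smul (ω₀ := fun y ↦ show E [⋀^Fin m]→L[ℝ] ℂ from
    (residueFormula ψ F 1 k (residueJdx F (projLift ψ k y)) y).restrictScalars ℝ) hη.isOfType b (x := x) rfl hden
  rw [key, hnum, zero_div, zero_smul]
  rfl

/-- **`Ωᵐ(M) = 0`** under the hypotheses of `eq_zero_of_isHolomorphicInCharts`: the space of `m`-forms holomorphic in
charts (`holFormsInCharts`) is trivial, `dim_ℂ Ωᵐ(M) = 0`. [cite: Arapura2012, §17.3 (17.3.1)] -/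
theorem finrank_holFormsInCharts_eq_zero [CompactSpace M] [ConnectedSpace M] [IsManifold 𝓘(ℝ, E) ∞ M]
    (hF : F.IsHomogeneous d) (hd : 1 ≤ d) (hdm : d ≤ m + 1) (hψ : Topology.IsEmbedding ψ)
    (hrange : Set.range ψ ⊆ projZeroLocus {F})
    (hjac : ∀ z : Fin (m + 2) → ℂ, z ≠ 0 → MvPolynomial.eval z F = 0 →
      ∃ j, MvPolynomial.eval z (MvPolynomial.pderiv j F) ≠ 0)
    (hhol : HasHolomorphicCoords E ψ) (hdim : Module.finrank ℂ E = m) (hm : 0 < m) :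
    Module.finrank ℂ ↥(holFormsInCharts E M m) = 0 := by
  have hbot : holFormsInCharts E M m = ⊥ := by
    rw [Submodule.eq_bot_iff]
    intro η hη
    exact eq_zero_of_isHolomorphicInCharts ψ hF hd hdm hψ hrange hjac hhol hdim hm
      ((mem_holFormsInCharts_iff).mp hη)
  rw [hbot, finrank_bot]

end Main

end Summit.HodgeConjecture.HodgeConjecture.Theorems.SmoothHypersurfaceTopFormsVanish

end
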